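import Summits.FinalStateConjecture.FinalStateConjecture.Theses.ExactKerrEnds
import Summits.FinalStateConjecture.FinalStateConjecture.Theorems.PhaseMixingCaptureWeakCosmicCensorshipMGHD
import Summits.FinalStateConjecture.FinalStateConjecture.Theorems.SwallowTheDatumParametricKerrBurialLine
import Summits.FinalStateConjecture.FinalStateConjecture.Theorems.SwallowTheDatumSubdataDevelopmentsEmbedLocalisationHolds
import Summits.FinalStateConjecture.FinalStateConjecture.Theorems.ExactKerrEndsSettlingAlongCensoredKerrEndsShape
import Literature.Geometry.Lorentzian.ExactKerrEnd
import HarnessLib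

/-!
# Crux `CensorshipAlongKerrEnds` (stmt-FinalStateConjecture-18521): THE BLACK-HOLE CORNER —
# Kerr-SHIELDED data are Kerr-ended and censored, so the crux holds along shielded curves

The crux `CensorshipAlongKerrEnds` (route `ExactKerrEnds`) asks, for every tame curve of admissible data
whose members off `0` are KERR-ENDED (exactly a Kerr leaf outside a compact set, `HasExactKerrEnd`), for a
tame injective immersed curve through the same base whose members off `0` are Kerr-ended AND CENSORED
(every maximal vacuum Cauchy development has complete `𝓘⁺`, sojourn form).  Two corners of the admissible
class were already certified in the tree: the DISPERSIVE corner (CK-small data on `ℝ³`, conditional on the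
stability of Minkowski space, `…NearMinkowski.lean`) and the MASSLESS corner (`M ≤ 0`, conditional on the
positive mass theorem with rigidity, `…NonposMassCensored.lean`).  This file certifies the third, BLACK-HOLE
corner: data which ALREADY CONTAIN an exact sub-extremal Kerr black hole — *Kerr-shielded* data
(`SwallowTheDatum.ParametricKerrBurial.IsKerrShielded`: outside a compact set the datum is the exact bent
horizon-penetrating Kerr leaf `{r > r₁}`, `r₋ < r₁ < r₊`, `|a| < M`, of crux `ParametricKerrBurial`,
stmt-10052) — whatever the datum is inside.

* `hasExactKerrEnd_of_isKerrShielded` — a Kerr-shielded datum is Kerr-ended (unconditional: the shield IS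
  exact Kerr end data with exceptional set `(range φ)ᶜ`).
* `censored_of_isKerrShielded` — GRANTED EXTERIOR IGNORANCE (`SwallowTheDatum.SubdataDevelopmentsEmbed`,
  stmt-10053, by name), an admissible Kerr-shielded datum is censored: the tapered Kerr collar over the
  shield is a vacuum Cauchy development of the exterior sub-datum realised inside exact Kerr
  (`stub_collarRealisation`, fed by `KerrShieldedSettles.stub_collarCauchy` and `stub_kerrVacuum`), its
  far-origin rays are complete or sojourn long by the explicit Kerr optics (`stub_farSojournTransfer` fed by
  `KerrShieldedSettles.stub_kerrLeafSojourn`), the far shield is co-compact in `X` (`stub_shieldCocompact`),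
  exterior ignorance embeds the collar development into any maximal development over `φ`, and complete
  `𝓘⁺` ascends along that embedding (`stub_scriTransfer`).  This is the body of
  `PhaseMixingCapture.WeakCosmicCensorshipMGHD.WeakCosmicCensorshipMGHD_of` (crux stmt-9952, line
  `scri-transfer-third-of-burial`) run for ONE shielded datum instead of the members of a burial family;
  `censored_of_isKerrShielded_of_choquetBruhatGeroch` is the same with exterior ignorance discharged from
  the single named fact `choquetBruhat_geroch_exists_mghd_cauchy` (Choquet-Bruhat–Geroch 1969, Thm. 3) by
  the landed `subdataDevelopmentsEmbed_of_choquetBruhatGeroch`.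
* `censorshipAlongKerrEnds_constCase_of_isKerrShielded` — the CONSTANT CASE of the crux at every admissible
  Kerr-shielded base (its breathing curve, `kerrEndedCensoredSelfWitness`), and
  `censorshipAlongKerrEnds_of_isKerrShieldedMembers` — the statement of the crux for every tame curve whose
  members off `0` are Kerr-shielded (immersed-injective or constant), both granted exterior ignorance; the
  `_of_choquetBruhatGeroch` forms take the Choquet-Bruhat–Geroch fact instead.

What remains OPEN of the crux after the three corners is exactly the collapse regime: Kerr-ended data that
are neither small, nor massless, nor already shielded by a formed exact Kerr exterior — there censoredness of
nearby Kerr-ended data is the positive-codimension weak cosmic censorship problem (line `Sketch`).  A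
shielded datum differs from a general Kerr-ended one only in WHERE the exact Kerr region begins (inside the
event horizon rather than far out); the tame curves of the crux cannot move that radius inwards (the
receding-shield families of crux `ParametricKerrBurial` are smooth but not tame), which is why this corner
does not propagate.

References: Christodoulou, CQG 16 (1999) A23, pp. A24–A27; Dafermos–Rodnianski arXiv:0811.0354 §2.6.2, §5.1;
Choquet-Bruhat–Geroch, CMP 14 (1969), Thm. 3; Hawking–Ellis 1973, §7.6; Li–Mei arXiv:2005.01249 §2.2;
Corvino–Schoen, JDG 73 (2006), §1.
-/

-- the doubled `FinalStateConjecture.FinalStateConjecture` path component trips dupNamespace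
set_option linter.dupNamespace false

noncomputable section

open Set Function Filter TopologicalSpace
open scoped Manifold ContDiff Topology

namespace Summit.FinalStateConjecture.FinalStateConjecture.Theorems.ExactKerrEnds.CensorshipAlongKerrEnds

open Literature.Geometry.Lorentzian
open Summit.FinalStateConjecture (HasCompleteNullInfinity)
open Summit.FinalStateConjecture.FinalStateConjecture.Theses.SwallowTheDatum (SubdataDevelopmentsEmbed)
open Summit.FinalStateConjecture.FinalStateConjecture.Theorems.SwallowTheDatum.ParametricKerrBurial
  (IsKerrShielded)
open Summit.FinalStateConjecture.FinalStateConjecture.Theorems.KerrShieldedDataExist.Negative (bentHeight)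
open Summit.FinalStateConjecture.FinalStateConjecture.Theorems.PhaseMixingCapture.WeakCosmicCensorshipMGHD
  (stub_scriTransfer stub_collarRealisation stub_kerrVacuum stub_farSojournTransfer stub_shieldCocompact)
open Summit.FinalStateConjecture.FinalStateConjecture.Theorems.SubdataDevelopmentsEmbed
  (subdataDevelopmentsEmbed_of_choquetBruhatGeroch)

variable {X : Type} [TopologicalSpace X] [ChartedSpace E3 X] [IsManifold (𝓡 3) ∞ X] [T2Space X]
  [SecondCountableTopology X] [ConnectedSpace X]

/-! ## §1 Shielded data are Kerr-ended -/

omit [T2Space X] [SecondCountableTopology X] [ConnectedSpace X] in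
/-- **A Kerr-shielded datum is Kerr-ended** (unconditional).  The shield `(M, a, r₁, φ, ψ, ν)` of
`IsKerrShielded X d` IS exact Kerr end data for `d` in the sense of `IsExactKerrEndAlong` with exceptional
set `K = (range φ)ᶜ` and chart domain `U = Kerr.slice a r₁`: the graph leaf `ψ y = (T(r(y)), y)` is
injective, and the two pull-back identities `φ^* h = ψ^* g_{M,a}`, `φ^* k = K_ν` evaluated on pairs of vectors
are the metric and second-fundamental-form clauses (`pullbackBilin_apply`).  Li–Mei arXiv:2005.01249 §2.2;
Corvino–Schoen 2006, §1. -/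
theorem hasExactKerrEnd_of_isKerrShielded [Kerr.Facts] {d : InitialDataSet (𝓡 3) X}
    (hS : IsKerrShielded X d) : d.HasExactKerrEnd := by
  obtain ⟨M, a, r₁, hM₀, T, φ, ψ, ν, -, -, -, -, hcpt, hopen, hφs, hψ, hsp, hν, hh, hk⟩ := hS
  have hψinj : Injective ψ := by
    intro y y' hyy'
    have h := congrArg (fun q : Kerr.region a r₁ ↦ (q : E4)) hyy'
    simp only [hψ] at h
    have h3 : (y : E3) = (y' : E3) := by
      simpa using congrArg E4.spatial h
    exact Subtype.ext h3
  intro _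
  refine ⟨(range φ)ᶜ, Kerr.slice a r₁, M, a, r₁, hM₀, φ, ψ, ν, hcpt, by rw [compl_compl], hopen, hφs,
    hψinj, hsp, hν, fun y v w _ ↦ ?_, ?_⟩
  · have h := congrArg (fun B ↦ B v w) (hh y)
    simp only [pullbackBilin_apply] at h
    exact h
  · intro _ y v w _
    have h := congrArg (fun B ↦ B v w) (hk y)
    simp only [pullbackBilin_apply, ContinuousLinearMap.toLinearMap₁₂_apply] at h
    exact h

/-! ## §2 Shielded data are censored, granted exterior ignorance -/

/-- **An admissible Kerr-shielded datum is censored, granted exterior ignorance**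
(`SubdataDevelopmentsEmbed`, stmt-10053, hypothesis BY NAME): every maximal vacuum Cauchy development of it
has complete future null infinity in the sojourn form of the summit.  Proof = the body of
`WeakCosmicCensorshipMGHD_of` for one datum: realise the tapered collar over the shield as a vacuum Cauchy
development `𝒦` of the exterior sub-datum inside exact Kerr (`stub_collarRealisation` with
`KerrShieldedSettles.stub_collarCauchy`, `stub_kerrVacuum`); its far-origin rays are complete or sojourn long
(`stub_farSojournTransfer` with `KerrShieldedSettles.stub_kerrLeafSojourn`); far shields are co-compact
(`stub_shieldCocompact`); exterior ignorance embeds `𝒦` into the maximal `𝒟` over `φ`; the lever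
`stub_scriTransfer` transfers.  Christodoulou, CQG 16 (1999), pp. A26–A27; Hawking–Ellis 1973, §7.6;
Choquet-Bruhat–Geroch 1969, Thm. 3. -/
theorem censored_of_isKerrShielded (hE : SubdataDevelopmentsEmbed) [Kerr.Facts]
    {d : InitialDataSet (𝓡 3) X} (hd : d ∈ admissibleVacuumData X) (hS : IsKerrShielded X d) :
    ∀ 𝒟 : VacuumCauchyDevelopment d, 𝒟.IsMaximal → HasCompleteNullInfinity 𝒟.toCauchyDevelopment := by
  intro 𝒟 hmax
  obtain ⟨M, a, r₁, hM₀, T, φ, ψ, ν, ha, hr₁, hr₂, rfl, hcpt, hopen, hφs, hψ, hsp, hν, hh, hk⟩ := hS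
  haveI : ConnectedSpace (Kerr.slice a r₁) :=
    isConnected_iff_connectedSpace.mp (Kerr.isConnected_slice_holds a r₁)
  have hsub : Kerr.IsSubextremal M a := ha
  -- the tapered collar realised as a vacuum development of the exterior sub-datum
  obtain ⟨hΦ, hΦ', 𝒦, j, hreal⟩ :=
    stub_collarRealisation X d M a r₁ hM₀ φ ψ ν
      ⟨ha, hr₁, hr₂, hcpt, hopen, hφs, hψ, hsp, hν, hh, hk⟩
      (Summit.FinalStateConjecture.FinalStateConjecture.Theorems.SwallowTheDatum.KerrShieldedSettles.stub_collarCauchy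
        M a r₁ hM₀ ha hr₁ hr₂)
      (stub_kerrVacuum M a r₁ hsub)
  -- exterior ignorance: `𝒦` embeds into the maximal development over `φ`
  obtain ⟨χ, hχ, hχo, hiso, hτ, hcomm⟩ := hE X d 𝒟 hmax (Kerr.slice a r₁) φ hΦ hΦ' hopen 𝒦
  -- `HasCompleteNullInfinity` binds the Levi-Civita instance of `𝒟`; introduce it
  intro hLC
  refine stub_scriTransfer X d 𝒟.toCauchyDevelopment (Kerr.slice a r₁) φ hΦ hΦ' hopen
    𝒦.toDataEmbedding χ hχ hχo hiso hτ hcomm (Set.range φ)ᶜ hcpt (by rw [compl_compl]) ?_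
  intro _instK
  -- far-origin completeness of `𝒦`, read at the bound instance
  obtain ⟨R₀, hR₀⟩ :=
    stub_farSojournTransfer X d M a r₁ hM₀ φ ψ ν
      ⟨ha, hr₁, hr₂, hcpt, hopen, hφs, hψ, hsp, hν, hh, hk⟩ hΦ hΦ' 𝒦 j hreal
      (Summit.FinalStateConjecture.FinalStateConjecture.Theorems.SwallowTheDatum.KerrShieldedSettles.stub_kerrLeafSojourn
        M a r₁ hM₀ ha hr₁ hr₂ ψ ν hψ hν)
  -- compact containers in `X`
  obtain ⟨K₀, hK₀c, hK₀⟩ := stub_shieldCocompact X d hd M a r₁ hM₀ φ ψ ν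
    ⟨ha, hr₁, hr₂, hcpt, hopen, hφs, hψ, hsp, hν, hh, hk⟩ (R₀ + 1)
  refine ⟨K₀, hK₀c, fun s hs ↦ ?_⟩
  obtain ⟨R₁, hR₁⟩ := hR₀ s hs
  obtain ⟨K₁, hK₁c, hK₁⟩ := stub_shieldCocompact X d hd M a r₁ hM₀ φ ψ ν
    ⟨ha, hr₁, hr₂, hcpt, hopen, hφs, hψ, hsp, hν, hh, hk⟩ R₁
  refine ⟨K₁, hK₁c, fun p hp γ dom hγ ↦ ?_⟩
  have hpR : R₁ ≤ Kerr.radius a (E4.ofTimeSpace 0 (p : E3)) := by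
    obtain ⟨y', hy', hyp⟩ := hK₁ hp
    rw [← hopen.injective hyp]
    exact hy'
  rcases hR₁ p hpR γ dom hγ with h | h
  · exact Or.inl h
  · refine Or.inr (h.trans (sojournTime_mono _ _ (LorentzianMetric.causalFuture_mono
      (image_mono fun y' hy' ↦ ?_))))
    -- `{r ≤ R₀} ⊆ φ⁻¹ K₀`: a far shield point outside `K₀` has radius `≥ R₀ + 1`
    by_contra hn
    obtain ⟨y'', hy'', he⟩ := hK₀ hn
    have := hopen.injective he
    subst this
    simp only [Set.mem_setOf_eq] at hy' hy''
    linarith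

/-- **An admissible Kerr-shielded datum is censored, granted the Choquet-Bruhat–Geroch theorem**: the
same with exterior ignorance discharged from the named fact `choquetBruhat_geroch_exists_mghd_cauchy`
(existence of maximal globally hyperbolic vacuum developments; Choquet-Bruhat–Geroch, CMP 14 (1969),
Thm. 3) by the landed `subdataDevelopmentsEmbed_of_choquetBruhatGeroch`.  CONDITIONAL on that one named
fact.  [cite: ChoquetBruhatGeroch1969CMP, Thm. 3 and p. 334] -/
theorem censored_of_isKerrShielded_of_choquetBruhatGeroch (hcbg : choquetBruhat_geroch_exists_mghd_cauchy)
    [Kerr.Facts] {d : InitialDataSet (𝓡 3) X} (hd : d ∈ admissibleVacuumData X)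
    (hS : IsKerrShielded X d) :
    ∀ 𝒟 : VacuumCauchyDevelopment d, 𝒟.IsMaximal → HasCompleteNullInfinity 𝒟.toCauchyDevelopment :=
  censored_of_isKerrShielded (subdataDevelopmentsEmbed_of_choquetBruhatGeroch hcbg) hd hS

/-! ## §3 The crux along shielded curves -/

/-- **THE CONSTANT CASE OF THE CRUX AT A KERR-SHIELDED BASE** (granted exterior ignorance,
`SubdataDevelopmentsEmbed`): through every admissible Kerr-shielded datum `d` passes a tame, injective,
immersed curve of admissible data, `F' 0 = d`, ALL of whose members are Kerr-ended and censored — the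
conclusion of `CensorshipAlongKerrEnds` at the base `d` (legend `KerrEnded = HasExactKerrEnd`,
`InitialDataSet.hasExactKerrEnd_iff`): `d` is Kerr-ended (`hasExactKerrEnd_of_isKerrShielded`) and censored
(`censored_of_isKerrShielded`), and its breathing curve is the witness (`kerrEndedCensoredSelfWitness`).
Christodoulou, CQG 16 (1999), p. A24. -/
theorem censorshipAlongKerrEnds_constCase_of_isKerrShielded (hE : SubdataDevelopmentsEmbed) [Kerr.Facts] :
    ∀ d ∈ admissibleVacuumData X, IsKerrShielded X d →
      ∃ (e' : AFEnd X) (F' : EuclideanSpace ℝ (Fin 1) → InitialDataSet (𝓡 3) X),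
        InitialDataSet.IsTameDataFamily e' 1 F' ∧ F' 0 = d ∧ Injective F' ∧
          InitialDataSet.IsImmersedAtZero 1 F' ∧ (∀ c, F' c ∈ admissibleVacuumData X) ∧
            ∀ c, (F' c).HasExactKerrEnd ∧
              ∀ 𝒟 : VacuumCauchyDevelopment (F' c), 𝒟.IsMaximal →
                HasCompleteNullInfinity 𝒟.toCauchyDevelopment :=
  fun _ hd hS ↦ kerrEndedCensoredSelfWitness hd (hasExactKerrEnd_of_isKerrShielded hS)
    (censored_of_isKerrShielded hE hd hS)

/-- **THE CRUX RESTRICTED TO CURVES WHOSE MEMBERS OFF `0` ARE KERR-SHIELDED** (granted exterior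
ignorance, `SubdataDevelopmentsEmbed`): the statement of `CensorshipAlongKerrEnds` holds for every tame curve
`F` of admissible data, immersed-injective or constant, whose members off `0` are Kerr-shielded: those
members are Kerr-ended (`hasExactKerrEnd_of_isKerrShielded`) and censored outright
(`censored_of_isKerrShielded`), so in the immersed-injective case `F` itself answers, and in the constant case
the base is shielded and its breathing curve answers (`kerrEndedCensoredSelfWitness`).  The Kerr-ended
hypothesis of the crux is implied here and therefore not repeated.  Christodoulou, CQG 16 (1999), p. A24;
Hawking–Ellis 1973, §7.6. -/
theorem censorshipAlongKerrEnds_of_isKerrShieldedMembers (hE : SubdataDevelopmentsEmbed) [Kerr.Facts] :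
    ∀ (e : AFEnd X) (F : EuclideanSpace ℝ (Fin 1) → InitialDataSet (𝓡 3) X),
      InitialDataSet.IsTameDataFamily e 1 F →
      (InitialDataSet.IsImmersedAtZero 1 F ∧ Injective F ∨ ∀ c, F c = F 0) →
      (∀ c, F c ∈ admissibleVacuumData X) →
      (∀ c ≠ 0, IsKerrShielded X (F c)) →
      ∃ (e' : AFEnd X) (F' : EuclideanSpace ℝ (Fin 1) → InitialDataSet (𝓡 3) X),
        InitialDataSet.IsTameDataFamily e' 1 F' ∧ F' 0 = F 0 ∧ Injective F' ∧
          InitialDataSet.IsImmersedAtZero 1 F' ∧ (∀ c, F' c ∈ admissibleVacuumData X) ∧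
            ∀ c ≠ 0, (F' c).HasExactKerrEnd ∧
              ∀ 𝒟 : VacuumCauchyDevelopment (F' c), 𝒟.IsMaximal →
                HasCompleteNullInfinity 𝒟.toCauchyDevelopment := by
  intro e F hF halt hadm hS
  rcases halt with ⟨himm, hinj⟩ | hconst
  · exact ⟨e, F, hF, rfl, hinj, himm, hadm, fun c hc ↦
      ⟨hasExactKerrEnd_of_isKerrShielded (hS c hc), censored_of_isKerrShielded hE (hadm c) (hS c hc)⟩⟩
  · -- constant case: the base `F 0 = F c₁` (`c₁ ≠ 0`) is shielded; breathe it
    have hc₁ : (EuclideanSpace.single (0 : Fin 1) (1 : ℝ) : EuclideanSpace ℝ (Fin 1)) ≠ 0 := by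
      intro h
      have h' := congrArg (fun v : EuclideanSpace ℝ (Fin 1) ↦ v 0) h
      simp at h'
    have hS₀ : IsKerrShielded X (F 0) := by
      rw [← hconst (EuclideanSpace.single 0 1)]; exact hS _ hc₁
    obtain ⟨e', F', hF', h0, hinj, himm, hadm', hall⟩ :=
      censorshipAlongKerrEnds_constCase_of_isKerrShielded hE (F 0) (hadm 0) hS₀
    exact ⟨e', F', hF', h0, hinj, himm, hadm', fun c _ ↦ hall c⟩

/-- **The constant case at a Kerr-shielded base, granted the Choquet-Bruhat–Geroch theorem** (named fact
`choquetBruhat_geroch_exists_mghd_cauchy`; CONDITIONAL on it).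
[cite: ChoquetBruhatGeroch1969CMP, Thm. 3 and p. 334] -/
theorem censorshipAlongKerrEnds_constCase_of_isKerrShielded_of_choquetBruhatGeroch
    (hcbg : choquetBruhat_geroch_exists_mghd_cauchy) [Kerr.Facts] :
    ∀ d ∈ admissibleVacuumData X, IsKerrShielded X d →
      ∃ (e' : AFEnd X) (F' : EuclideanSpace ℝ (Fin 1) → InitialDataSet (𝓡 3) X),
        InitialDataSet.IsTameDataFamily e' 1 F' ∧ F' 0 = d ∧ Injective F' ∧
          InitialDataSet.IsImmersedAtZero 1 F' ∧ (∀ c, F' c ∈ admissibleVacuumData X) ∧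
            ∀ c, (F' c).HasExactKerrEnd ∧
              ∀ 𝒟 : VacuumCauchyDevelopment (F' c), 𝒟.IsMaximal →
                HasCompleteNullInfinity 𝒟.toCauchyDevelopment :=
  censorshipAlongKerrEnds_constCase_of_isKerrShielded (subdataDevelopmentsEmbed_of_choquetBruhatGeroch hcbg)

/-- **The crux along curves with Kerr-shielded members off `0`, granted the Choquet-Bruhat–Geroch
theorem** (named fact `choquetBruhat_geroch_exists_mghd_cauchy`; CONDITIONAL on it).
[cite: ChoquetBruhatGeroch1969CMP, Thm. 3 and p. 334] -/
theorem censorshipAlongKerrEnds_of_isKerrShieldedMembers_of_choquetBruhatGeroch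
    (hcbg : choquetBruhat_geroch_exists_mghd_cauchy) [Kerr.Facts] :
    ∀ (e : AFEnd X) (F : EuclideanSpace ℝ (Fin 1) → InitialDataSet (𝓡 3) X),
      InitialDataSet.IsTameDataFamily e 1 F →
      (InitialDataSet.IsImmersedAtZero 1 F ∧ Injective F ∨ ∀ c, F c = F 0) →
      (∀ c, F c ∈ admissibleVacuumData X) →
      (∀ c ≠ 0, IsKerrShielded X (F c)) →
      ∃ (e' : AFEnd X) (F' : EuclideanSpace ℝ (Fin 1) → InitialDataSet (𝓡 3) X),
        InitialDataSet.IsTameDataFamily e' 1 F' ∧ F' 0 = F 0 ∧ Injective F' ∧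
          InitialDataSet.IsImmersedAtZero 1 F' ∧ (∀ c, F' c ∈ admissibleVacuumData X) ∧
            ∀ c ≠ 0, (F' c).HasExactKerrEnd ∧
              ∀ 𝒟 : VacuumCauchyDevelopment (F' c), 𝒟.IsMaximal →
                HasCompleteNullInfinity 𝒟.toCauchyDevelopment :=
  censorshipAlongKerrEnds_of_isKerrShieldedMembers (subdataDevelopmentsEmbed_of_choquetBruhatGeroch hcbg)

/-! ## §4 Appended (session 12): the base alone decides — the crux at every curve with a shielded base -/

/-- **THE CRUX AT EVERY TAME CURVE WHOSE BASE IS KERR-SHIELDED** (granted exterior ignorance,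
`SubdataDevelopmentsEmbed`): the conclusion of `CensorshipAlongKerrEnds` asks for SOME tame injective immersed
curve through the base `F 0` with Kerr-ended censored members — it never has to be the given curve `F`.  Hence the
hypotheses of the crux on `F` (tameness, the immersed-injective/constant alternative, Kerr-ended members off `0`)
are idle as soon as the BASE is an admissible Kerr-shielded datum: its breathing curve answers
(`censorshipAlongKerrEnds_constCase_of_isKerrShielded`).  This is the strongest form of the black-hole corner:
membership of the base in the shielded class, not of the members.  Christodoulou, CQG 16 (1999), p. A24. -/
theorem censorshipAlongKerrEnds_of_isKerrShieldedBase (hE : SubdataDevelopmentsEmbed) [Kerr.Facts]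
    (F : EuclideanSpace ℝ (Fin 1) → InitialDataSet (𝓡 3) X) (h0 : F 0 ∈ admissibleVacuumData X)
    (hS : IsKerrShielded X (F 0)) :
    ∃ (e' : AFEnd X) (F' : EuclideanSpace ℝ (Fin 1) → InitialDataSet (𝓡 3) X),
      InitialDataSet.IsTameDataFamily e' 1 F' ∧ F' 0 = F 0 ∧ Injective F' ∧
        InitialDataSet.IsImmersedAtZero 1 F' ∧ (∀ c, F' c ∈ admissibleVacuumData X) ∧
          ∀ c ≠ 0, (F' c).HasExactKerrEnd ∧
            ∀ 𝒟 : VacuumCauchyDevelopment (F' c), 𝒟.IsMaximal →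
              HasCompleteNullInfinity 𝒟.toCauchyDevelopment := by
  obtain ⟨e', F', hF', h0', hinj, himm, hadm', hall⟩ :=
    censorshipAlongKerrEnds_constCase_of_isKerrShielded hE (F 0) h0 hS
  exact ⟨e', F', hF', h0', hinj, himm, hadm', fun c _ ↦ hall c⟩

/-- **The crux at every curve with a Kerr-shielded base, granted the Choquet-Bruhat–Geroch theorem** (named fact
`choquetBruhat_geroch_exists_mghd_cauchy`; CONDITIONAL on it). [cite: ChoquetBruhatGeroch1969CMP, Thm. 3 and p. 334] -/
theorem censorshipAlongKerrEnds_of_isKerrShieldedBase_of_choquetBruhatGeroch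
    (hcbg : choquetBruhat_geroch_exists_mghd_cauchy) [Kerr.Facts]
    (F : EuclideanSpace ℝ (Fin 1) → InitialDataSet (𝓡 3) X) (h0 : F 0 ∈ admissibleVacuumData X)
    (hS : IsKerrShielded X (F 0)) :
    ∃ (e' : AFEnd X) (F' : EuclideanSpace ℝ (Fin 1) → InitialDataSet (𝓡 3) X),
      InitialDataSet.IsTameDataFamily e' 1 F' ∧ F' 0 = F 0 ∧ Injective F' ∧
        InitialDataSet.IsImmersedAtZero 1 F' ∧ (∀ c, F' c ∈ admissibleVacuumData X) ∧
          ∀ c ≠ 0, (F' c).HasExactKerrEnd ∧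
            ∀ 𝒟 : VacuumCauchyDevelopment (F' c), 𝒟.IsMaximal →
              HasCompleteNullInfinity 𝒟.toCauchyDevelopment :=
  censorshipAlongKerrEnds_of_isKerrShieldedBase (subdataDevelopmentsEmbed_of_choquetBruhatGeroch hcbg) F h0 hS

end Summit.FinalStateConjecture.FinalStateConjecture.Theorems.ExactKerrEnds.CensorshipAlongKerrEnds

end
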